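import Summits.CriticalPhenomena.PercolationContinuityZ3.Theorems.PercNearOneGluingNoHeavyQuantFlowPieces
import Summits.CriticalPhenomena.PercolationContinuityZ3.Theorems.PercNearOneGluingNoHeavyQuantLawDecUsageMonge
import Summits.CriticalPhenomena.PercolationContinuityZ3.Theorems.PercNearOneGluingNoHeavyQuantLawDecFlowsDecomposition
import Summits.CriticalPhenomena.PercolationContinuityZ3.Theorems.PercNearOneGluingNoHeavyQuantRootScaledHeavyRoots
import HarnessLib

/-!
# QUANT lane R8, T-DEC: THE FIRST-MOMENT BUDGET CRITERION — a law is DEC at EVERY layer as soon as the torque demand of its POSITIVE low atoms,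
# `Σ_l μ(l)·(T − l)`, is covered by the torque budget `Σ μ(h)·(h − T)` of the atoms above the target that are TORQUE-SAFE for them
# (`y·(h − l) ≤ T − l`); no partner choice, any number of low atoms (arm-1 gen 49, architect — the multi-low tool toward `ResidDEC`)

builds on p205010 (kernel theorem, internal audit signed; external expert review pending)

Support file (`--supports stmt-CriticalPhenomena-4575`), QUANT lane seat prim-quant-arm-1 (gen 49, architect), rung R8 of
`run/shared/lean/prim/quant/LADDER.md`; memo `run/shared/lean/prim/quant/prim-quant-arm-1-g49/ARCH-G49.md` §5–§6.  Theorems only (no definitions), standard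
axioms, no sorries.  Law-level sequel of typer g26's first-moment criterion (`flowAtT_of_moment`: the only low atom is `0`) and census-1 g24's ONE-LOW peeling
lemma (`decAt_all_of_oneLow`, `…QuantDECOneLow`: one positive low atom, one dedicated partner); vocabulary `FlowAtT`/`usage`/`pairGate` (`…QuantLawDecFlows`),
`usage_mid_mul_le`/`usage_zero_mul_le` (`…QuantFlowPieces`), `usage_giant_eq` (`…QuantLawDecUsageMonge`), `decAtT_of_flowAtT`.

THE CRITERION (any number of positive low atoms, NO partner choice).  `A ≥ 0` on `{0..M}`, target `T > 0`, floor `0 < y < 1`, `y·M ≤ T`, first moment at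
least the target (`T·ΣA ≤ Σ h·A h`).  TORQUE BOOK-KEEPING: an atom `h > T` carries the budget `β(h) = A(h)·(h − T)`; by the torque identity the total budget
is `≥ T·A(0) + Σ_{0<l<T} A(l)·(T − l)` — the zero atom's levers `{0, h; T/h}` cost exactly `T` per unit (`usage_zero_mul_le`), a positive low `l` shipped to a
MID `h > T` at its credit gate costs `≤ T − l` per unit (`usage_mid_mul_le`), and shipped to a GIANT `h` at the floor gate costs `y·(h − T)/(1 − y)`, which is
`≤ T − l` exactly when `y·(h − l) ≤ T − l` ('torque-safe').  Hence: if a ceiling `H` is torque-safe for every charged positive low atom (`y·(H − l) ≤ T − l`;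
e.g. `H = ⌊l_max + (T − l_max)/y⌋`, `≥ 2T − l_max ≥ 3T/2` at light floors) and the DEMAND of the positive lows fits into the budget BELOW the ceiling,
  `Σ_{l ≥ 1, 2l < T} A(l)·(T − l) ≤ Σ_{T < h ≤ H} A(h)·(h − T)`,
then `FlowAtT y T j′ M A` at EVERY layer `j′ < M` (**`flowAtT_of_budget`**: positive lows ship proportionally to the safe budgets, the zero atom to what is
left of all budgets — both proportional flows respect every capacity by the rate inequalities); for a probability law at its mean, `DECAt y j′ M μ` for every
`j′ < M` (**`decAt_all_of_budget`**).  With no positive low atom the demand is `0` and this is `decAt_all_of_noLow`; the one-low lemma needs a capacity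
inequality at one partner, this one a budget inequality over all safe partners.

THE USE — `ResidDEC` (✓ p421540, the node of record, README V431).  **`residDECAt_of_budget`**: for tree-OK siblings (`≥ 2`, `0 < a < 1`) the residual
`R_a = resid a (wco a L) L` satisfies `ResidDECAt x a L` as soon as its positive low atoms obey the criterion at `(y, T) = (a·x, a·fmean L)`.  EXACT SCAN
(explore/budget_scan.py, memo §5): on the identical glued forests `(R^A[q](R^B[s]))^k`, shapes (A,B) ∈ {11,12,13,14,21,22,23,32}, `k ∈ {3,4,5,6,8,10}`,
`q ≤ .98`, light floors `qs ≤ 1/2`, `a ∈ {.1,…,.999}` — 41 280 exact (forest, a) pairs — the criterion with the natural ceiling certifies the residual at EVERY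
point but 4 (the gapped shapes (1,3)/(1,4) at `k = 3`, `q = .98`, `a ≥ .99`: two low atoms {2, 3}, where the near absorbers `h ≤ T` that the budget ignores are
needed) — the no-low regime covers 27–100 % of these points, the budget criterion the rest, k-generally.

* `usage_mul_le_of_safe` (a torque-safe absorber above the target costs `≤ T − l` per unit, giant or mid);
* **`flowAtT_of_budget`**, **`decAt_all_of_budget`**, **`residDECAt_of_budget`**.

HONEST STATUS: a law-level DEC criterion and its residual wrapper; `ResidDEC`, `SiblingStep`, `GateStepN`, `FarTreeRow` OPEN; RATE class log\* / honest
sentence of `run/shared/lean/prim/quant/README.md` unchanged.  [this work]; flow normal form / first-moment criterion: this lane (typer g22–g26); one-low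
peeling: prim-quant-census-1 g24; node of record: lead g47 / typer g41.  Nothing here is cited as a published result.  The gluing rows served
[cite: KozmaNitzan2024, Conjecture 3 (p. 15)]; product measure [cite: Grimmett1999, §1.3 p. 10].
-/

noncomputable section

open scoped BigOperators

namespace Summit.CriticalPhenomena.PercolationContinuityZ3.Theorems
namespace Quant
namespace LawDec

open Finset

/-! ### A torque-safe absorber above the target is cheap for a positive low -/

/-- **a torque-safe absorber costs at most `T − l` per unit**: for a low `l` (`2l < T`), an absorber `h > T` with `y·h ≤ T` and `y·(h − l) ≤ T − l`,
`usage y T j′ l h · (h − T) ≤ T − l` whatever the layer (giant: `y(h−T)/(1−y) ≤ T − l` is the safety; mid: `usage_mid_mul_le`). [this work] -/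
theorem usage_mul_le_of_safe (y T : ℝ) (j' l h : ℕ) (hy0 : 0 < y) (hy1 : y < 1) (hlow : 2 * (l : ℝ) < T) (hTh : T < (h : ℝ))
    (hta : y * (h : ℝ) ≤ T) (hsafe : y * ((h : ℝ) - l) ≤ T - l) :
    usage y T j' l h * ((h : ℝ) - T) ≤ T - l := by
  by_cases hg : j' + 1 ≤ h
  · rw [usage_giant_eq y T j' l h hg]
    have h1y : 0 < 1 - y := by linarith
    rw [div_mul_eq_mul_div, div_le_iff₀ h1y]
    nlinarith
  · have hl0 : (0 : ℝ) ≤ l := Nat.cast_nonneg l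
    exact usage_mid_mul_le y T j' l h hy0 hy1 hlow (by omega) (by linarith) hta

/-! ### The budget criterion -/

/-- **THE FIRST-MOMENT BUDGET CRITERION (flow form).**  `A ≥ 0` on `{0..M}` (vanishing above `M`), target `T > 0`, floor `0 < y < 1`, `y·M ≤ T`,
first moment `≥ T·mass`; a ceiling `H` torque-safe for every charged positive low atom (`y·(H − l) ≤ T − l`); and the demand of the positive low atoms
covered by the budget of the atoms in `(T, H]`: `Σ_{1 ≤ l, 2l < T} A(l)(T − l) ≤ Σ_{T < h ≤ H} A(h)(h − T)`.  Then `FlowAtT y T j′ M A` for every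
`j′ < M`. [this work] -/
theorem flowAtT_of_budget (y T : ℝ) (j' M H : ℕ) (A : ℕ → ℝ) (hy0 : 0 < y) (hy1 : y < 1) (hT : 0 < T) (hj : j' < M)
    (hA0 : ∀ h, 0 ≤ A h) (hAM : ∀ h, M < h → A h = 0) (hta : y * (M : ℝ) ≤ T)
    (hmom : T * ∑ h ∈ Finset.range (M + 1), A h ≤ ∑ h ∈ Finset.range (M + 1), (h : ℝ) * A h)
    (hsafe : ∀ l : ℕ, 1 ≤ l → 2 * (l : ℝ) < T → 0 < A l → y * ((H : ℝ) - l) ≤ T - l)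
    (hbud : ∑ l ∈ Finset.range (M + 1), (if (1 ≤ l ∧ 2 * (l : ℝ) < T) then A l * (T - l) else 0)
      ≤ ∑ h ∈ Finset.range (M + 1), (if (T < (h : ℝ) ∧ h ≤ H) then A h * ((h : ℝ) - T) else 0)) :
    FlowAtT y T j' M A := by
  classical
  -- demand of the positive lows, safe budget, total budget
  set wL : ℕ → ℝ := fun l => if (1 ≤ l ∧ 2 * (l : ℝ) < T) then A l * (T - l) else 0 with hwL
  set βS : ℕ → ℝ := fun h => if (T < (h : ℝ) ∧ h ≤ H) then A h * ((h : ℝ) - T) else 0 with hβS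
  set β : ℕ → ℝ := fun h => if T < (h : ℝ) then A h * ((h : ℝ) - T) else 0 with hβ
  set D : ℝ := ∑ l ∈ Finset.range (M + 1), wL l with hD
  set BS : ℝ := ∑ h ∈ Finset.range (M + 1), βS h with hBS
  set B : ℝ := ∑ h ∈ Finset.range (M + 1), β h with hB
  have hwL0 : ∀ l, 0 ≤ wL l := fun l => by
    simp only [hwL]; split_ifs with hc
    · have : (l : ℝ) < T := by linarith [hc.2, (Nat.cast_nonneg l : (0 : ℝ) ≤ l)]
      exact mul_nonneg (hA0 l) (by linarith)
    · exact le_rfl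
  have hβS0 : ∀ h, 0 ≤ βS h := fun h => by
    simp only [hβS]; split_ifs with hc
    · exact mul_nonneg (hA0 h) (by linarith [hc.1])
    · exact le_rfl
  have hβSβ : ∀ h, βS h ≤ β h := fun h => by
    simp only [hβS, hβ]
    by_cases hc : T < (h : ℝ) ∧ h ≤ H
    · rw [if_pos hc, if_pos hc.1]
    · rw [if_neg hc]
      split_ifs
      · exact mul_nonneg (hA0 h) (by linarith)
      · exact le_rfl
  have hβM : ∀ h, M < h → β h = 0 := fun h hh => by
    simp only [hβ]; split_ifs
    · rw [hAM h hh, zero_mul]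
    · rfl
  have hD0 : 0 ≤ D := Finset.sum_nonneg fun l _ => hwL0 l
  have hBS0 : 0 ≤ BS := Finset.sum_nonneg fun h _ => hβS0 h
  have hDBS : D ≤ BS := hbud
  -- the torque identity: `B ≥ T·A 0 + D`
  have hBge : T * A 0 + D ≤ B := by
    have hpt : ∀ h ∈ Finset.range (M + 1),
        ((h : ℝ) - T) * A h ≤ β h - wL h - (if h = 0 then T * A h else 0) := by
      intro h _
      have hh0 : (0 : ℝ) ≤ h := Nat.cast_nonneg h
      have hAh := hA0 h
      simp only [hβ, hwL]
      by_cases hTh : T < (h : ℝ)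
      · have h1 : ¬ (1 ≤ h ∧ 2 * (h : ℝ) < T) := fun hc => by linarith [hc.2]
        have h0 : h ≠ 0 := by rintro rfl; simp only [Nat.cast_zero] at hTh; linarith
        rw [if_pos hTh, if_neg h1, if_neg h0]; linarith
      · rw [if_neg hTh]
        by_cases h0 : h = 0
        · subst h0
          have h1 : ¬ (1 ≤ 0 ∧ 2 * ((0 : ℕ) : ℝ) < T) := fun hc => by omega
          rw [if_neg h1, if_pos rfl]; simp only [Nat.cast_zero]; nlinarith
        · rw [if_neg h0]
          by_cases h1 : (1 ≤ h ∧ 2 * (h : ℝ) < T)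
          · rw [if_pos h1]; nlinarith
          · rw [if_neg h1]; nlinarith
    have hsum := Finset.sum_le_sum hpt
    rw [Finset.sum_sub_distrib, Finset.sum_sub_distrib, Finset.sum_ite_eq' (Finset.range (M + 1)) 0,
      if_pos (Finset.mem_range.2 (Nat.succ_pos M))] at hsum
    have e : ∑ h ∈ Finset.range (M + 1), ((h : ℝ) - T) * A h
        = ∑ h ∈ Finset.range (M + 1), (h : ℝ) * A h - T * ∑ h ∈ Finset.range (M + 1), A h := by
      rw [Finset.mul_sum, ← Finset.sum_sub_distrib]
      exact Finset.sum_congr rfl fun h _ => by ring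
    rw [e] at hsum
    linarith
  -- the fraction of the safe budget used by the positive lows, and the budget left to the zero atom
  set θ : ℝ := D / BS with hθ
  have hθ0 : 0 ≤ θ := div_nonneg hD0 hBS0
  have hθ1 : θ ≤ 1 := by
    rcases hBS0.eq_or_lt with hz | hpos
    · rw [hθ, ← hz, div_zero]; exact zero_le_one
    · exact (div_le_one hpos).2 hDBS
  have hθBS : θ * BS = D := by
    rcases hBS0.eq_or_lt with hz | hpos
    · have hD' : D = 0 := le_antisymm (by rw [hz]; exact hDBS) hD0
      rw [← hz, mul_zero, hD']
    · rw [hθ, div_mul_cancel₀ _ hpos.ne']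
  set R : ℝ := B - D with hR
  have hRge : T * A 0 ≤ R := by rw [hR]; linarith
  have hR0 : 0 ≤ R := le_trans (mul_nonneg hT.le (hA0 0)) hRge
  have hrem0 : ∀ h, 0 ≤ β h - θ * βS h := fun h => by
    have : θ * βS h ≤ 1 * βS h := mul_le_mul_of_nonneg_right hθ1 (hβS0 h)
    linarith [hβSβ h]
  have hremsum : ∑ h ∈ Finset.range (M + 1), (β h - θ * βS h) = R := by
    rw [Finset.sum_sub_distrib, ← Finset.mul_sum, hθBS]
  -- if the safe budget vanishes, so does every positive low atom
  have hAl_of_BS : BS = 0 → ∀ l, l ≤ M → 1 ≤ l → 2 * (l : ℝ) < T → A l = 0 := by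
    intro hz l hlM hl1 hllow
    have hD' : D = 0 := le_antisymm (by rw [← hz]; exact hDBS) hD0
    have hterm : wL l = 0 :=
      (Finset.sum_eq_zero_iff_of_nonneg (fun l _ => hwL0 l)).1 hD' l (Finset.mem_range.2 (by omega))
    simp only [hwL, if_pos (show 1 ≤ l ∧ 2 * (l : ℝ) < T from ⟨hl1, hllow⟩)] at hterm
    have hTl : 0 < T - l := by linarith [(Nat.cast_nonneg l : (0 : ℝ) ≤ l)]
    rcases mul_eq_zero.1 hterm with h | h
    · exact h
    · linarith
  -- THE WITNESS: positive lows proportional to the safe budgets, the zero atom to what is left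
  refine ⟨fun l h => (if (1 ≤ l ∧ l ≤ j' ∧ 2 * (l : ℝ) < T) then A l * βS h / BS else 0)
      + (if l = 0 then A 0 * (β h - θ * βS h) / R else 0),
    fun l h => ?_, fun l h hp => ?_, fun l hl hlow => ?_, fun h hhM habs => ?_⟩
  · -- nonnegativity
    refine add_nonneg ?_ ?_
    · split_ifs
      · exact div_nonneg (mul_nonneg (hA0 l) (hβS0 h)) hBS0
      · exact le_rfl
    · split_ifs
      · exact div_nonneg (mul_nonneg (hA0 0) (hrem0 h)) hR0
      · exact le_rfl
  · -- support: only lows ship, only to atoms above the target and below the top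
    dsimp only at hp
    have key : T < (h : ℝ) ∧ h ≤ M := by
      by_contra hn
      have hβz : β h = 0 := by
        by_cases h1 : T < (h : ℝ)
        · exact hβM h (by by_contra hle; exact hn ⟨h1, not_lt.1 hle⟩)
        · simp only [hβ, if_neg h1]
      have hβSz : βS h = 0 := le_antisymm (by rw [← hβz]; exact hβSβ h) (hβS0 h)
      have hz : (if (1 ≤ l ∧ l ≤ j' ∧ 2 * (l : ℝ) < T) then A l * βS h / BS else 0)
          + (if l = 0 then A 0 * (β h - θ * βS h) / R else 0) = 0 := by
        rw [hβSz, hβz]; split_ifs <;> simp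
      rw [hz] at hp
      exact lt_irrefl _ hp
    obtain ⟨hTh, hhM'⟩ := key
    by_cases hl0 : l = 0
    · subst hl0
      exact ⟨Nat.zero_le _, by simpa using hT, hhM', Or.inr (by simpa using hTh)⟩
    · have hc : 1 ≤ l ∧ l ≤ j' ∧ 2 * (l : ℝ) < T := by
        by_contra hn
        rw [if_neg hn, if_neg hl0, add_zero] at hp
        exact lt_irrefl _ hp
      exact ⟨hc.2.1, hc.2.2, hhM', Or.inr (by linarith [(Nat.cast_nonneg l : (0 : ℝ) ≤ l)])⟩
  · -- rows: every low atom is shipped exactly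
    dsimp only
    by_cases hl0 : l = 0
    · subst hl0
      have e : ∀ h ∈ Finset.range (M + 1),
          ((if (1 ≤ 0 ∧ 0 ≤ j' ∧ 2 * ((0 : ℕ) : ℝ) < T) then A 0 * βS h / BS else 0)
            + (if (0 : ℕ) = 0 then A 0 * (β h - θ * βS h) / R else 0)) = A 0 * (β h - θ * βS h) / R := by
        intro h _
        rw [if_neg (fun hc => by omega), if_pos rfl, zero_add]
      rw [Finset.sum_congr rfl e, ← Finset.sum_div, ← Finset.mul_sum, hremsum]
      rcases hR0.eq_or_lt with hz | hpos
      · have hA00 : A 0 = 0 := le_antisymm (by nlinarith [hRge, hz.symm]) (hA0 0)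
        rw [hA00, zero_mul, zero_div]
      · rw [mul_div_assoc, div_self hpos.ne', mul_one]
    · have hl1 : 1 ≤ l := Nat.one_le_iff_ne_zero.2 hl0
      have e : ∀ h ∈ Finset.range (M + 1),
          ((if (1 ≤ l ∧ l ≤ j' ∧ 2 * (l : ℝ) < T) then A l * βS h / BS else 0)
            + (if l = 0 then A 0 * (β h - θ * βS h) / R else 0)) = A l * βS h / BS := by
        intro h _
        rw [if_pos ⟨hl1, hl, hlow⟩, if_neg hl0, add_zero]
      rw [Finset.sum_congr rfl e, ← Finset.sum_div, ← Finset.mul_sum]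
      rcases hBS0.eq_or_lt with hz | hpos
      · rw [hAl_of_BS hz.symm l (by omega) hl1 hlow, zero_mul, zero_div]
      · rw [mul_div_assoc, div_self hpos.ne', mul_one]
  · -- columns: every absorber is loaded by at most its mass
    dsimp only
    by_cases hTh : T < (h : ℝ)
    · have hyh : y * (h : ℝ) ≤ T := le_trans (mul_le_mul_of_nonneg_left (by exact_mod_cast hhM) hy0.le) hta
      have hhT : 0 < (h : ℝ) - T := by linarith
      have hβh : β h = A h * ((h : ℝ) - T) := by simp only [hβ, if_pos hTh]
      -- the positive lows load `h` by at most `θ·A h·[h ≤ H]`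
      have hlows : ∑ l ∈ Finset.range (j' + 1),
          usage y T j' l h * (if (1 ≤ l ∧ l ≤ j' ∧ 2 * (l : ℝ) < T) then A l * βS h / BS else 0) ≤ θ * βS h / ((h : ℝ) - T) := by
        have hpt : ∀ l ∈ Finset.range (j' + 1),
            usage y T j' l h * (if (1 ≤ l ∧ l ≤ j' ∧ 2 * (l : ℝ) < T) then A l * βS h / BS else 0)
              ≤ wL l * (βS h / (((h : ℝ) - T) * BS)) := by
          intro l _
          have hnn : 0 ≤ wL l * (βS h / (((h : ℝ) - T) * BS)) :=
            mul_nonneg (hwL0 l) (div_nonneg (hβS0 h) (mul_nonneg hhT.le hBS0))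
          by_cases hc : 1 ≤ l ∧ l ≤ j' ∧ 2 * (l : ℝ) < T
          · rw [if_pos hc]
            rcases hBS0.eq_or_lt with hz | hBpos
            · have : A l = 0 := hAl_of_BS hz.symm l (by omega) hc.1 hc.2.2
              rw [this, zero_mul, zero_div, mul_zero]; exact hnn
            · by_cases hsf : h ≤ H
              · rcases (hA0 l).eq_or_lt with hzl | hlpos
                · rw [← hzl, zero_mul, zero_div, mul_zero]; exact hnn
                · have hs : y * ((h : ℝ) - l) ≤ T - l := by
                    have h1 : y * ((h : ℝ) - l) ≤ y * ((H : ℝ) - l) :=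
                      mul_le_mul_of_nonneg_left (by simp only [sub_le_sub_iff_right]; exact_mod_cast hsf) hy0.le
                    exact h1.trans (hsafe l hc.1 hc.2.2 hlpos)
                  have hu := usage_mul_le_of_safe y T j' l h hy0 hy1 hc.2.2 hTh hyh hs
                  have ewl : wL l = A l * (T - l) := by
                    simp only [hwL, if_pos (show 1 ≤ l ∧ 2 * (l : ℝ) < T from ⟨hc.1, hc.2.2⟩)]
                  have e1 : A l * βS h / BS = ((h : ℝ) - T) * (A l * βS h / (((h : ℝ) - T) * BS)) := by
                    rw [← mul_div_assoc, mul_div_mul_left _ _ hhT.ne']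
                  rw [e1, ← mul_assoc, ewl,
                    show A l * (T - ↑l) * (βS h / ((↑h - T) * BS)) = (T - l) * (A l * βS h / (((h : ℝ) - T) * BS)) by ring]
                  exact mul_le_mul_of_nonneg_right hu (div_nonneg (mul_nonneg (hA0 l) (hβS0 h)) (mul_nonneg hhT.le hBS0))
              · have : βS h = 0 := by
                  simp only [hβS]; rw [if_neg (show ¬ (T < (h : ℝ) ∧ h ≤ H) from fun hc' => hsf hc'.2)]
                rw [this]; simp
          · rw [if_neg hc, mul_zero]; exact hnn
        refine (Finset.sum_le_sum hpt).trans ?_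
        rw [← Finset.sum_mul]
        have hDj : ∑ l ∈ Finset.range (j' + 1), wL l ≤ D :=
          Finset.sum_le_sum_of_subset_of_nonneg (Finset.range_mono (by omega)) (fun l _ _ => hwL0 l)
        rcases hBS0.eq_or_lt with hz | hBpos
        · have hθz : θ = 0 := by rw [hθ, ← hz, div_zero]
          rw [← hz, hθz]; simp
        · calc (∑ l ∈ Finset.range (j' + 1), wL l) * (βS h / (((h : ℝ) - T) * BS))
              ≤ D * (βS h / (((h : ℝ) - T) * BS)) :=
                mul_le_mul_of_nonneg_right hDj (div_nonneg (hβS0 h) (mul_nonneg hhT.le hBS0))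
            _ = θ * βS h / ((h : ℝ) - T) := by
                rw [hθ]; field_simp
      -- the zero atom loads `h` by at most what is left
      have hzero : ∑ l ∈ Finset.range (j' + 1),
          usage y T j' l h * (if l = 0 then A 0 * (β h - θ * βS h) / R else 0) ≤ (β h - θ * βS h) / ((h : ℝ) - T) := by
        rw [Finset.sum_eq_single 0 (fun l _ hl => by rw [if_neg hl, mul_zero])
          (fun hn => absurd (Finset.mem_range.2 (Nat.succ_pos j')) hn), if_pos rfl]
        have hu := usage_zero_mul_le y T j' h hy0 hy1 hT (Or.inr hTh) hyh
        have h2 : 0 ≤ (β h - θ * βS h) / ((h : ℝ) - T) := div_nonneg (hrem0 h) hhT.le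
        rcases hR0.eq_or_lt with hz | hRpos
        · have hA00 : A 0 = 0 := le_antisymm (by nlinarith [hRge, hz.symm]) (hA0 0)
          rw [hA00, zero_mul, zero_div, mul_zero]; exact h2
        · have hRne : R ≠ 0 := hRpos.ne'
          have hhTne : (h : ℝ) - T ≠ 0 := hhT.ne'
          have e1 : usage y T j' 0 h * (A 0 * (β h - θ * βS h) / R)
              = usage y T j' 0 h * ((h : ℝ) - T) * (A 0 / R) * ((β h - θ * βS h) / ((h : ℝ) - T)) := by
            field_simp
          rw [e1]
          have h1 : usage y T j' 0 h * ((h : ℝ) - T) * (A 0 / R) ≤ 1 := by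
            calc usage y T j' 0 h * ((h : ℝ) - T) * (A 0 / R) ≤ T * (A 0 / R) :=
                  mul_le_mul_of_nonneg_right hu (div_nonneg (hA0 0) hR0)
              _ = T * A 0 / R := by ring
              _ ≤ 1 := (div_le_one hRpos).2 hRge
          calc usage y T j' 0 h * ((h : ℝ) - T) * (A 0 / R) * ((β h - θ * βS h) / ((h : ℝ) - T))
              ≤ 1 * ((β h - θ * βS h) / ((h : ℝ) - T)) := mul_le_mul_of_nonneg_right h1 h2
            _ = (β h - θ * βS h) / ((h : ℝ) - T) := one_mul _
      -- total
      have e : ∀ l, usage y T j' l h * ((if (1 ≤ l ∧ l ≤ j' ∧ 2 * (l : ℝ) < T) then A l * βS h / BS else 0)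
            + (if l = 0 then A 0 * (β h - θ * βS h) / R else 0))
          = usage y T j' l h * (if (1 ≤ l ∧ l ≤ j' ∧ 2 * (l : ℝ) < T) then A l * βS h / BS else 0)
            + usage y T j' l h * (if l = 0 then A 0 * (β h - θ * βS h) / R else 0) := fun l => by ring
      rw [Finset.sum_congr rfl fun l _ => e l, Finset.sum_add_distrib]
      refine (add_le_add hlows hzero).trans ?_
      rw [← add_div, div_le_iff₀ hhT, hβh]
      nlinarith [hβS0 h, hθ0]
    · -- at or below the target nothing arrives
      have hz : ∀ l ∈ Finset.range (j' + 1),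
          usage y T j' l h * ((if (1 ≤ l ∧ l ≤ j' ∧ 2 * (l : ℝ) < T) then A l * βS h / BS else 0)
            + (if l = 0 then A 0 * (β h - θ * βS h) / R else 0)) = 0 := by
        intro l _
        have h1 : βS h = 0 := by
          simp only [hβS]; rw [if_neg (show ¬ (T < (h : ℝ) ∧ h ≤ H) from fun hc => hTh hc.1)]
        have h2 : β h = 0 := by simp only [hβ, if_neg hTh]
        rw [h1, h2]; split_ifs <;> simp
      rw [Finset.sum_congr rfl hz, Finset.sum_const_zero]
      exact hA0 h

/-- **THE BUDGET CRITERION AT THE MEAN.**  A probability law `μ` on `{0..M}` with mean `T > 0`, floor `0 < y < 1`, `y·M ≤ T`, a ceiling `H` torque-safe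
for its charged positive low atoms and the budget inequality, is DEC at floor `y` at every layer `j′ < M`. [this work] -/
theorem decAt_all_of_budget (y : ℝ) (M H : ℕ) (μ : ℕ → ℝ) (T : ℝ) (hy0 : 0 < y) (hy1 : y < 1)
    (hμ0 : ∀ h, 0 ≤ μ h) (hμM : ∀ h, M < h → μ h = 0) (hμ1 : ∑ h ∈ Finset.range (M + 1), μ h = 1)
    (hT : ∑ h ∈ Finset.range (M + 1), (h : ℝ) * μ h = T) (hT0 : 0 < T) (hta : y * (M : ℝ) ≤ T)
    (hsafe : ∀ l : ℕ, 1 ≤ l → 2 * (l : ℝ) < T → 0 < μ l → y * ((H : ℝ) - l) ≤ T - l)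
    (hbud : ∑ l ∈ Finset.range (M + 1), (if (1 ≤ l ∧ 2 * (l : ℝ) < T) then μ l * (T - l) else 0)
      ≤ ∑ h ∈ Finset.range (M + 1), (if (T < (h : ℝ) ∧ h ≤ H) then μ h * ((h : ℝ) - T) else 0)) :
    ∀ j', j' < M → DECAt y j' M μ := by
  intro j' hj'
  rw [decAt_iff_decAtT, hT]
  exact decAtT_of_flowAtT y T j' M μ hy0 hy1 hμM hμ1
    (flowAtT_of_budget y T j' M H μ hy0 hy1 hT0 hj' hμ0 hμM hta (by rw [hμ1, hT, mul_one]) hsafe hbud)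

/-! ### The residual wrapper -/

/-- **`ResidDECAt` FROM THE BUDGET CRITERION.**  Tree-built siblings at floor `0 < x < 1` (at least two, so that `wco a L < 1`), `0 < a < 1`: if the
residual `R_a = resid a (wco a L) L` has a ceiling `H` torque-safe for its charged positive low atoms at `(y, T) = (a·x, a·fmean L)` and its positive-low
demand is covered by the budget of its atoms in `(T, H]`, then `ResidDECAt x a L` (the residual is DEC at `a·x` at every layer below the top; V431's node
at this list and gate). [this work] -/
theorem residDECAt_of_budget {x a : ℝ} (hx0 : 0 < x) (hx1 : x < 1) (ha0 : 0 < a) (ha1 : a < 1) (H : ℕ) (L : List Sib)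
    (hL : ∀ s ∈ L, s.TreeOK x) (hk : 2 ≤ L.length)
    (hsafe : ∀ l : ℕ, 1 ≤ l → 2 * (l : ℝ) < a * fmean L → 0 < resid a (wco a L) L l →
      (a * x) * ((H : ℝ) - l) ≤ a * fmean L - l)
    (hbud : ∑ l ∈ Finset.range (ftop L + 1),
        (if (1 ≤ l ∧ 2 * (l : ℝ) < a * fmean L) then resid a (wco a L) L l * (a * fmean L - l) else 0)
      ≤ ∑ h ∈ Finset.range (ftop L + 1),
        (if (a * fmean L < (h : ℝ) ∧ h ≤ H) then resid a (wco a L) L h * ((h : ℝ) - a * fmean L) else 0)) :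
    ∀ j, j < ftop L → DECAt (a * x) j (ftop L) (resid a (wco a L) L) := by
  have hL' : ∀ s ∈ L, s.LawOK := fun s hs => (hL s hs).lawOK
  have hne : L ≠ [] := by rintro rfl; simp at hk
  obtain ⟨s, t, L', rfl⟩ : ∃ s t L', L = s :: t :: L' := by
    rcases L with _ | ⟨s, _ | ⟨t, L'⟩⟩
    · exact absurd rfl hne
    · simp at hk
    · exact ⟨s, t, L', rfl⟩
  have hw1 : wco a (s :: t :: L') < 1 := wco_lt_one ha1 s t L' hL'
  obtain ⟨r0, rM, r1, rmn⟩ := resid_laws ha0 ha1.le (s :: t :: L') hL' le_rfl hw1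
  have hax0 : 0 < a * x := mul_pos ha0 hx0
  have hax1 : a * x < 1 := by nlinarith
  have hfm : 0 < fmean (s :: t :: L') := (fmean_pos _ hL).2 hne
  have hT0 : 0 < a * fmean (s :: t :: L') := mul_pos ha0 hfm
  have hta : a * x * (ftop (s :: t :: L') : ℝ) ≤ a * fmean (s :: t :: L') := by
    rw [mul_assoc]
    exact mul_le_mul_of_nonneg_left (ftop_mul_floor_le_fmean hx0 hx1 _ hL) ha0.le
  exact decAt_all_of_budget (a * x) (ftop (s :: t :: L')) H (resid a (wco a (s :: t :: L')) (s :: t :: L')) (a * fmean (s :: t :: L'))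
    hax0 hax1 r0 rM r1 rmn hT0 hta hsafe hbud

end LawDec
end Quant
end Summit.CriticalPhenomena.PercolationContinuityZ3.Theorems
-- ops-buildfix 2026-08-26T07:4xZ: comment-only enqueue re-land (accepted 05:31Z, stranded without a build dispatch; no content change).
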